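import Summits.ValiantsHypothesis.ValiantsHypothesis.Theorems.LacunarySymmetroidMatrixDescartesCensusV19CCheck
import Summits.ValiantsHypothesis.ValiantsHypothesis.Theorems.LacunarySymmetroidMatrixDescartesCensusV19CShells2324Keys

/-!
# `MatrixDescartes` census — CASE C (`V = 19`), shells `d₅ ∈ {23, 24}`: kernel COVER check, top `d₅ = 24`, slices `[(24, 17, 18), (24, 19, 19)]`

HONEST FRAMING.  Object-search cell `pub-symmetroid`; door-A item `DoorA26 = PosRootLawAt 2 6 19` (stmt-ValiantsHypothesis-19979; OPEN, typed, never asserted).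
Kernel bookkeeping only: `V19C.coverSlicesX caseC2324Open shells2324Keys` on these slices (every sorted support there is not one-collision, an exception, a key, or the
mirror of a key); rows with more than 900 supports are checked in pieces by the first free exponent `d₁` (`V20.incLists 3 1 n` is a `flatMap` over `d₁`, `List.all_flatMap`)
and reassembled.  The meaning is attached in the assembly `…CensusV19CShells2324` by `V19C.box_of_planX` (`…CensusV19CSoundCover`).  Nothing here bears on the
`2`-Sidon supports, on `ζ_sym(2,6)`, on `DoorA26`, on `MatrixDescartes` (stmt-ValiantsHypothesis-18050) or on `VP ≠ VNP`.

[folklore] Bookkeeping; elementary.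
-/

-- the D-0017 layout repeats a namespace component (single-conjunct summit); the `dupNamespace` linter flags it; name mandated.
set_option linter.dupNamespace false

namespace Summit.ValiantsHypothesis.ValiantsHypothesis.Theorems.LacunarySymmetroidMatrixDescartes.Census.V19C

open V20 (incLists keysTop)

set_option maxHeartbeats 4000000 in
set_option maxRecDepth 200000 in
/-- Cover check of the slice `(24, 17, 18)`. [folklore] -/
theorem ccover2324_24b_s1 : coverSlicesX caseC2324Open shells2324Keys [(24, 17, 18)] = true := by
  decide +kernel

set_option maxHeartbeats 4000000 in
set_option maxRecDepth 200000 in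
/-- Cover check of the slice `(24, 19, 19)`. [folklore] -/
theorem ccover2324_24b_s2 : coverSlicesX caseC2324Open shells2324Keys [(24, 19, 19)] = true := by
  decide +kernel

/-- The cover slices of this file together. [folklore] -/
theorem ccover2324_24b : coverSlicesX caseC2324Open shells2324Keys [(24, 17, 18), (24, 19, 19)] = true := by
  have h1 := ccover2324_24b_s1; have h2 := ccover2324_24b_s2
  unfold coverSlicesX at h1 h2 ⊢
  simp only [List.all_cons, List.all_nil, Bool.and_true, Bool.and_eq_true] at h1 h2 ⊢
  exact ⟨h1, h2⟩

end Summit.ValiantsHypothesis.ValiantsHypothesis.Theorems.LacunarySymmetroidMatrixDescartes.Census.V19C
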